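import Summits.BirchSwinnertonDyer.BirchSwinnertonDyer.Theorems.QuadraticBranchSignedControlPlusEtaNonsurjPlusCoeffCongruenceReadings
import Summits.BirchSwinnertonDyer.BirchSwinnertonDyer.Theorems.QuadraticBranchSignedControlPlusEtaNonsurjConjADoorBSDRecordsR1TNj
import Summits.BirchSwinnertonDyer.BirchSwinnertonDyer.Theorems.QuadraticBranchSignedControlPlusEtaNonsurjConjADoorBSDRecordsR1TNk
import HarnessLib

/-!
# Route `QuadraticBranchSignedControl` (rung K8, cell `bsd-potss`), residual crux `PlusEtaMainConjectureNonsurj`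
# (stmt-BirchSwinnertonDyer-19606): `BSD_5` RECORDS R1NS(l) — `MissingPPartAt W 5` on `λ⁻ = 1` rank-one rows with BOTH analytic inputs READ OFF
# MODULAR SYMBOLS (level 1: `5 ∤ ϖ·coeff₁θ₁(η)` ⟹ unit `coeff₁L₅⁻`; level 2: `v₅(ϖ·coeff₁θ₂(η)) = 1` ⟹ `(L₅⁺) = (X)`), seat `bsd-potss-k8eta-c2` g24

WHAT. For each row the lineage holds g22's `missingPPartAt_r1n_<row>_5_of_<door>` displaying (N1) «unit first coefficient of `L_5⁻(V,η,X)`» and `hX`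
«`(L_5⁺(V,η,X)) = (X)`», both MEASURED by PARI `ellpadiclambdamu` (`λ^∓ = 1, μ^∓ = 0`). The records of THIS file display instead two exact-rational symbol
valuations and obtain (N1) / `hX` IN THE KERNEL through the θ-coefficient congruences (`…MinusCoeffCongruence{,Readings,Mazur}`,
`…PlusCoeffCongruence{,Readings}`; `‖ϖ‖₅ ≤ 1` from Mazur's `hM`, `L_5⁺(V,η,0) = 0` from `r_an(W) = 1` via EtaPrimeRoad). NUMBERS (kit j336534: g23's engine
MT-C1 stages 1–2, stage 2 extended to all levels, `p = 5`, `NMAX = 2`, on all 77 `λ⁻ = 1` record rows; pre-registered P-24D on STATUS): rows of this part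
176400kj1 (`Σu·TH₁ = 1`, `5 ∤`; `Σu·TH₂ = -70`, `v₅ = 1`); 19600cb1 (`Σu·TH₁ = -2`, `5 ∤`; `Σu·TH₂ = 10`, `v₅ = 1`); 216225bu1 (`Σu·TH₁ = 72`, `5 ∤`; `Σu·TH₂ = -360`, `v₅ = 1`). Everything else (row, door datum, named facts `hGZK hmod hnf hM h12 hKO hGZ h74 h22 h41 h6273`, (N2), (N3)) is VERBATIM the r1n record.

HONEST FRAMING (cell `bsd-potss`; FULL-BSD rank ≤ 1 programme, HUMAN RULING D-0036/D-0074): per-row RECORDS, CONDITIONAL on the named facts and on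
displayed per-row data; the symbol valuations are numerical data (exact rational arithmetic on numerically recovered symbols), evidence not kernel
facts; `BSD(W,5)` ASSERTED for no pair; C-cc-1 NOT proved; no stub of 19606 proved; crux and route OPEN; nothing booked. `--supports stmt-BirchSwinnertonDyer-19606`.

References: [Kobayashi2003] Thm. 1.2, 2.2, 3.2, (3.4)–(3.7), §4, Thm. 4.1, 6.2–7.4, 9.3; [Kobayashi2013]; [Pollack2003] Prop. 6.18; [Mazur1978] Cor. 4.1;
[KitajimaOtsuki2018] Main Thm. 1.3; [GrossZagier1986] I (7.3); [Miller2011LMS] Def. 1.1; [Cremona1997] Table 1.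
-/

set_option autoImplicit false
set_option linter.dupNamespace false
noncomputable section

open scoped Classical nonZeroDivisors

open CongruenceSubgroup NumberField Field WeierstrassCurve
open Literature.NumberTheory.EllipticCurves Literature.NumberTheory.EllipticCurves.ModularForms
  Literature.NumberTheory.EllipticCurves.Rank1Residual Literature.NumberTheory.EllipticCurves.Rank1Residual.Typed
  Literature.NumberTheory.GaloisRepresentations Literature.NumberTheory.GaloisCohomology Literature.NumberTheory.NumberFields
  Literature.NumberTheory.EllipticCurves.GreenbergVatsal2000 ZpExtension
open Summit.BirchSwinnertonDyer.Rank1Residual Summit.BirchSwinnertonDyer.Rank1Residual.Additive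
open Summit.BirchSwinnertonDyer.Rank1Residual.X11b (isElliptic_of_discOf_ne_zero)
open Summit.BirchSwinnertonDyer.BirchSwinnertonDyer.Theorems

namespace Summit.BirchSwinnertonDyer.BirchSwinnertonDyer.Theorems.EtaConjADoorBSDRecordsR1

/-- **[R1NS — BOTH analytic data from symbols, k8eta-c2 g24]** The `λ⁻ = 1` record `missingPPartAt_r1n_176400kj1_5_of_classNumber` of this namespace with (a) its displayed
(N1) «every minus branch function `L_5⁻(V,η,X)` has a UNIT coefficient of `X`» (PARI `λ⁻ = 1, μ⁻ = 0`) REPLACED by the level-1 symbol datum «`ϖ · coeff₁θ₁(η)`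
(`θ₁(η) = quadraticBranchMazurTateElement 5 f 1`, `20` symbols `[a/25]⁺`) is a `5`-adic UNIT» (kit j336534: `Σ_{u<5} u·TH₁[u] = 1` = `1`,
`5 ∤`), read by `EtaMinusCoeffCongruence.minusLeadingValuationAt_zero_of_mazurTate_padicValRat_of_indivisible_of_mazur` (`coeff₁L = −v·ϖ·coeff₁θ₁(η) + 5ϖr`), and
(b) its displayed `hX` «`(Lη) = (X)`» (PARI `λ⁺ = 1, μ⁺ = 0`) REPLACED by the level-2 symbol datum «`v₅(ϖ · coeff₁θ₂(η)) = 1`» (kit j336534: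
`Σ_{u<25} u·TH₂[u] = -70` = `−2·5·7`; `TH₀ = 0`, `Σ_u TH₁[u] = Σ_u TH₂[u] = 0`), read by
`EtaPlusCoeffCongruence.span_eq_span_X_of_mazurTate_padicValRat` (`L_5⁺(0) = 0` from `r_an = 1`; `coeff₁` unit; `‖ϖ‖₅ ≤ 1` from `hM`). No `p`-adic `L`-function
numerics remain in this record; convention changes move both numbers by `5`-adic units. The rest is VERBATIM the r1n record:** **`MissingPPartAt W 5` — `ord_5 #Ш(W) = ord_5 #Ш_an(W)` (from Miller's `BSDp W 5`) — for the CM CornerF in-table prime-`L` rank-one partner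
176400kj1, granted ONE good `a_5 = 0` globally minimal model `V` of `W^{(5)}` with non-onto `5`-adic tower, modulo named facts and DISPLAYED
NUMERICS ONLY (no conjecture instance: the `λ⁻ = 1` shape)** (`W = [0, 0, 0, 0, 3500]`, CM, `N_W = 176400`; kit QP5 (k8eta-c2 g20) / j326603 (g21) +
j332613 (twin λ±/μ±, etacomp) (GRH): `ε(W) = −1`, PARI plus-`η` `(λ, μ) = (1, 0)`, `r_an(W) = 1` (`Cremona rank 1; k8eta-c2 g19/g20 census`);
`h(ℚ(P)) = 24`, `h(ℚ(x(P))) = 3`; eigen dimensions `(d₁,d₂,d₃,d₄) = (0,0,0,0)` — door L6 (`5 ∤ h(ℚ(P))`) passes) from the ROW ALONE — named facts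
`hGZK hmod hnf hM h12 hKO hGZ h74 h22 h41 h6273` (GZK, modularity, newforms, Mazur `p ∤ c₀`, Kobayashi Thm. 1.2 / 2.2 / 4.1 / 6.2–7.4,
Kitajima–Otsuki Thm. 1.3, Gross–Zagier I (7.3); Poitou–Tate and the layer comparison are tree theorems); displayed: `r_an(W) = 1`, the twin `V` with
the tower clause, `(L_5⁺(V,η,X)) = (X)`, and — INSTEAD of the crux C-cc-1 at the row — three NUMERICAL data that make its `δ = 0` law trivially true
here: (N1) the level-1 SYMBOL valuation stated above, (N2) no
generator of `W(ℚ)/tors` is `5`-divisible in `W(ℚ_5)` (kit: `ν = 0`), (N3) `v_5(q·Tam/#tors²) = 0` for `q = #Ш_an(W)` (kit: `#Ш_an = 1`, `Tam = 8`,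
`#tors = 1`), the class-group datum. Instance of `EtaConjADoorBSDRankOne.bsdp_of_plusEtaMainConjectureAt_of_analyticRank_eq_one` ∘ g20's
`EtaConjADoorRecords.etaMC_r1_of_classNumber` with `hcc1 :=` `minusLeadingValuationAt_zero_of_unit_coeff_of_indivisible` (k8eta-c2 g22).
CONDITIONAL; nothing booked. [cite: Kobayashi2003, §4 (p. 8), Thm. 2.2 (p. 5)] [cite: CoatesSujatha2005, §3 (A) and Thm. 3.4] [cite: Cremona1997,
Table 1] -/
theorem missingPPartAt_r1ns_176400kj1_5_of_classNumber
    (hGZK : rank_eq_analyticRank_of_analyticRank_le_one) (hmod : hasEntireLFunction_rat)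
    (hnf : exists_isNewformOf) (hM : mazur_not_dvd_maninConstant_of_odd)
    (h12 : Kobayashi2003.thm12_signedSelmerDual_finite_torsion)
    (hKO : KitajimaOtsuki2018.mainThm13_etaSignedSelmerDual_noFiniteSubmodule)
    (hGZ : GrossZagier1986_thm_I_7_3) (h74 : Kobayashi2003.thm74_etaEvenMC_iff_etaOddMC)
    (h22 : Kobayashi2003.thm22_etaSignedSelmerDual_finite_torsion)
    (h41 : Kobayashi2003.thm41_plusEtaCharIdeal_dvd)
    (h6273 : Kobayashi2003.thm62_63_73_etaColemanPoitouTate) [Fact (5 : ℕ).Prime]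
    (W : WeierstrassCurve ℚ) (hW : W = (⟨0, 0, 0, 0, 3500⟩ : WeierstrassCurve ℚ)) (hr : W.analyticRank = 1)
    (V : WeierstrassCurve ℚ) [V.IsElliptic] [V.IsGloballyMinimal] (C : VariableChange ℚ)
    (hC : C • W.quadraticTwist 5 = V)
    (hgood : V.HasGoodReductionAtPrime 5) (hap : V.frobeniusTrace 5 = 0)
    (hns : ¬ ∀ m : ℕ, V.HasSurjectiveModNGaloisRep (5 ^ m : ℕ))
    (hθ₂ : ∀ {N : ℕ} [NeZero N] {f : CuspForm (Gamma0 N) 2}, IsNewformOf V f →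
      ∀ (ϖ : ℚ), (if Even (5 / 2) then (ϖ : ℝ) * V.realPeriodRat = plusPeriod f
          else (ϖ : ℝ) * V.imaginaryPeriodRat = minusPeriod f) →
      ϖ * (quadraticBranchMazurTateElement 5 f 2).coeff 1 ≠ 0 ∧
        padicValRat 5 (ϖ * (quadraticBranchMazurTateElement 5 f 2).coeff 1) = 1)
    (hP : haveI : W.IsElliptic := hW ▸ isElliptic_176400kj1
      haveI : NeZero (5 : ℕ) := ⟨by norm_num⟩
      haveI : NumberField (W.divisionField 5) := NumberField.mk
      ∃ P : geomTorsion W ((5 : ℕ) : ℤ), P ≠ 0 ∧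
        ¬ 5 ∣ NumberField.classNumber (IntermediateField.fixedField
          ((MulAction.stabilizer (absoluteGaloisGroup ℚ) P).map (absRestrictNormalHom (W.divisionField 5)))))
    (hθ : haveI : W.IsElliptic := hW ▸ isElliptic_176400kj1
      ∀ (V' : WeierstrassCurve ℚ) [V'.IsElliptic] [V'.IsGloballyMinimal] (C' : VariableChange ℚ)
        {N : ℕ} [NeZero N] {f : CuspForm (Gamma0 N) 2},
        C' • W.quadraticTwist 5 = V' → V'.HasGoodReductionAtPrime 5 → V'.frobeniusTrace 5 = 0 → IsNewformOf V' f →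
        ∀ (ϖ : ℚ), (if Even (5 / 2) then (ϖ : ℝ) * V'.realPeriodRat = plusPeriod f
            else (ϖ : ℝ) * V'.imaginaryPeriodRat = minusPeriod f) →
        ϖ * (quadraticBranchMazurTateElement 5 f 1).coeff 1 ≠ 0 ∧
          padicValRat 5 (ϖ * (quadraticBranchMazurTateElement 5 f 1).coeff 1) = 0)
    (hnd : haveI : W.IsElliptic := hW ▸ isElliptic_176400kj1
      ∀ P : W.toAffine.Point, ¬ IsOfFinAddOrder P →
        (∀ R : W.toAffine.Point, ∃ (k : ℤ) (T : W.toAffine.Point), IsOfFinAddOrder T ∧ R = k • P + T) →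
        ∀ Q : (W.baseChange ℚ_[5]).toAffine.Point, 5 • Q ≠ W.toPadicPoint 5 P)
    (hval : haveI : W.IsElliptic := hW ▸ isElliptic_176400kj1
      haveI : W.IsGloballyMinimal := hW ▸ isGloballyMinimal_176400kj1
      ∀ q : ℚ, shaAn W = (q : ℂ) → padicValRat 5 (q * W.tamagawaProduct / (W.torsionOrder : ℚ) ^ 2) = 0) :
    MissingPPartAt W 5 := by
  rw [← show ((-1 : ℚ) ^ ((5 : ℕ) / 2) * ((5 : ℕ) : ℚ)) = (5 : ℚ) by norm_num] at hθ
  subst hW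
  haveI : (⟨0, 0, 0, 0, 3500⟩ : WeierstrassCurve ℚ).IsElliptic := isElliptic_176400kj1
  haveI : (⟨0, 0, 0, 0, 3500⟩ : WeierstrassCurve ℚ).IsGloballyMinimal := isGloballyMinimal_176400kj1
  haveI : NeZero (5 : ℕ) := ⟨by norm_num⟩
  haveI : Finite (⟨0, 0, 0, 0, 3500⟩ : WeierstrassCurve ℚ).sha := (hGZK _ (by omega)).2
  exact missingPPartAt_of_bsdp _ 5 (EtaConjADoorBSDRankOne.bsdp_of_plusEtaMainConjectureAt_of_analyticRank_eq_one _ 5 hGZK hmod hnf hM h12 hKO hGZ h74 (le_refl 5) V C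
      (by rw [show ((-1 : ℚ) ^ ((5 : ℕ) / 2) * ((5 : ℕ) : ℚ)) = 5 by norm_num]; exact hC) hgood hap
      (EtaConjADoorRecords.etaMC_r1_of_classNumber h22 h41 h6273 hGZK 5 (le_refl 5) _ hr V C
        (by rw [show ((-1 : ℚ) ^ ((5 : ℕ) / 2) * ((5 : ℕ) : ℚ)) = 5 by norm_num]; exact hC) hgood hap hns
          (EtaPlusCoeffCongruence.span_eq_span_X_of_mazurTate_padicValRat 5 hmod hM (le_refl 5) _ hr V C
            (by rw [show ((-1 : ℚ) ^ ((5 : ℕ) / 2) * ((5 : ℕ) : ℚ)) = 5 by norm_num]; exact hC) hgood hap hθ₂) hP) hr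
    (EtaMinusCoeffCongruence.minusLeadingValuationAt_zero_of_mazurTate_padicValRat_of_indivisible_of_mazur _ 5 hM (le_refl 5)
      hθ hnd hval))

end Summit.BirchSwinnertonDyer.BirchSwinnertonDyer.Theorems.EtaConjADoorBSDRecordsR1

namespace Summit.BirchSwinnertonDyer.BirchSwinnertonDyer.Theorems.EtaConjADoorBSDRecordsR1

/-- **[R1NS — BOTH analytic data from symbols, k8eta-c2 g24]** The `λ⁻ = 1` record `missingPPartAt_r1n_19600cb1_5_of_classNumber` of this namespace with (a) its displayed
(N1) «every minus branch function `L_5⁻(V,η,X)` has a UNIT coefficient of `X`» (PARI `λ⁻ = 1, μ⁻ = 0`) REPLACED by the level-1 symbol datum «`ϖ · coeff₁θ₁(η)`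
(`θ₁(η) = quadraticBranchMazurTateElement 5 f 1`, `20` symbols `[a/25]⁺`) is a `5`-adic UNIT» (kit j336534: `Σ_{u<5} u·TH₁[u] = -2` = `−2`,
`5 ∤`), read by `EtaMinusCoeffCongruence.minusLeadingValuationAt_zero_of_mazurTate_padicValRat_of_indivisible_of_mazur` (`coeff₁L = −v·ϖ·coeff₁θ₁(η) + 5ϖr`), and
(b) its displayed `hX` «`(Lη) = (X)`» (PARI `λ⁺ = 1, μ⁺ = 0`) REPLACED by the level-2 symbol datum «`v₅(ϖ · coeff₁θ₂(η)) = 1`» (kit j336534: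
`Σ_{u<25} u·TH₂[u] = 10` = `2·5`; `TH₀ = 0`, `Σ_u TH₁[u] = Σ_u TH₂[u] = 0`), read by
`EtaPlusCoeffCongruence.span_eq_span_X_of_mazurTate_padicValRat` (`L_5⁺(0) = 0` from `r_an = 1`; `coeff₁` unit; `‖ϖ‖₅ ≤ 1` from `hM`). No `p`-adic `L`-function
numerics remain in this record; convention changes move both numbers by `5`-adic units. The rest is VERBATIM the r1n record:** **`MissingPPartAt W 5` — `ord_5 #Ш(W) = ord_5 #Ш_an(W)` (from Miller's `BSDp W 5`) — for the CM CornerF in-table prime-`L` rank-one partner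
19600cb1, granted ONE good `a_5 = 0` globally minimal model `V` of `W^{(5)}` with non-onto `5`-adic tower, modulo named facts and DISPLAYED NUMERICS
ONLY (no conjecture instance: the `λ⁻ = 1` shape)** (`W = [0, 0, 0, -875, 12250]`, CM, `N_W = 19600`; kit QP5 (k8eta-c2 g20) / j326603 (g21) +
j332613 (twin λ±/μ±, etacomp) (GRH): `ε(W) = −1`, PARI plus-`η` `(λ, μ) = (1, 0)`, `r_an(W) = 1` (`Cremona rank 1; k8eta-c2 g19/g20 census`);
`h(ℚ(P)) = 2`, `h(ℚ(x(P))) = 1`; eigen dimensions `(d₁,d₂,d₃,d₄) = (0,0,0,0)` — door L6 (`5 ∤ h(ℚ(P))`) passes) from the ROW ALONE — named facts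
`hGZK hmod hnf hM h12 hKO hGZ h74 h22 h41 h6273` (GZK, modularity, newforms, Mazur `p ∤ c₀`, Kobayashi Thm. 1.2 / 2.2 / 4.1 / 6.2–7.4,
Kitajima–Otsuki Thm. 1.3, Gross–Zagier I (7.3); Poitou–Tate and the layer comparison are tree theorems); displayed: `r_an(W) = 1`, the twin `V` with
the tower clause, `(L_5⁺(V,η,X)) = (X)`, and — INSTEAD of the crux C-cc-1 at the row — three NUMERICAL data that make its `δ = 0` law trivially true
here: (N1) the level-1 SYMBOL valuation stated above, (N2) no
generator of `W(ℚ)/tors` is `5`-divisible in `W(ℚ_5)` (kit: `ν = 0`), (N3) `v_5(q·Tam/#tors²) = 0` for `q = #Ш_an(W)` (kit: `#Ш_an = 1`, `Tam = 16`,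
`#tors = 2`), the class-group datum. Instance of `EtaConjADoorBSDRankOne.bsdp_of_plusEtaMainConjectureAt_of_analyticRank_eq_one` ∘ g20's
`EtaConjADoorRecords.etaMC_r1_of_classNumber` with `hcc1 :=` `minusLeadingValuationAt_zero_of_unit_coeff_of_indivisible` (k8eta-c2 g22).
CONDITIONAL; nothing booked. [cite: Kobayashi2003, §4 (p. 8), Thm. 2.2 (p. 5)] [cite: CoatesSujatha2005, §3 (A) and Thm. 3.4] [cite: Cremona1997,
Table 1] -/
theorem missingPPartAt_r1ns_19600cb1_5_of_classNumber
    (hGZK : rank_eq_analyticRank_of_analyticRank_le_one) (hmod : hasEntireLFunction_rat)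
    (hnf : exists_isNewformOf) (hM : mazur_not_dvd_maninConstant_of_odd)
    (h12 : Kobayashi2003.thm12_signedSelmerDual_finite_torsion)
    (hKO : KitajimaOtsuki2018.mainThm13_etaSignedSelmerDual_noFiniteSubmodule)
    (hGZ : GrossZagier1986_thm_I_7_3) (h74 : Kobayashi2003.thm74_etaEvenMC_iff_etaOddMC)
    (h22 : Kobayashi2003.thm22_etaSignedSelmerDual_finite_torsion)
    (h41 : Kobayashi2003.thm41_plusEtaCharIdeal_dvd)
    (h6273 : Kobayashi2003.thm62_63_73_etaColemanPoitouTate) [Fact (5 : ℕ).Prime]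
    (W : WeierstrassCurve ℚ) (hW : W = (⟨0, 0, 0, (-875), 12250⟩ : WeierstrassCurve ℚ)) (hr : W.analyticRank = 1)
    (V : WeierstrassCurve ℚ) [V.IsElliptic] [V.IsGloballyMinimal] (C : VariableChange ℚ)
    (hC : C • W.quadraticTwist 5 = V)
    (hgood : V.HasGoodReductionAtPrime 5) (hap : V.frobeniusTrace 5 = 0)
    (hns : ¬ ∀ m : ℕ, V.HasSurjectiveModNGaloisRep (5 ^ m : ℕ))
    (hθ₂ : ∀ {N : ℕ} [NeZero N] {f : CuspForm (Gamma0 N) 2}, IsNewformOf V f →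
      ∀ (ϖ : ℚ), (if Even (5 / 2) then (ϖ : ℝ) * V.realPeriodRat = plusPeriod f
          else (ϖ : ℝ) * V.imaginaryPeriodRat = minusPeriod f) →
      ϖ * (quadraticBranchMazurTateElement 5 f 2).coeff 1 ≠ 0 ∧
        padicValRat 5 (ϖ * (quadraticBranchMazurTateElement 5 f 2).coeff 1) = 1)
    (hP : haveI : W.IsElliptic := hW ▸ isElliptic_19600cb1
      haveI : NeZero (5 : ℕ) := ⟨by norm_num⟩
      haveI : NumberField (W.divisionField 5) := NumberField.mk
      ∃ P : geomTorsion W ((5 : ℕ) : ℤ), P ≠ 0 ∧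
        ¬ 5 ∣ NumberField.classNumber (IntermediateField.fixedField
          ((MulAction.stabilizer (absoluteGaloisGroup ℚ) P).map (absRestrictNormalHom (W.divisionField 5)))))
    (hθ : haveI : W.IsElliptic := hW ▸ isElliptic_19600cb1
      ∀ (V' : WeierstrassCurve ℚ) [V'.IsElliptic] [V'.IsGloballyMinimal] (C' : VariableChange ℚ)
        {N : ℕ} [NeZero N] {f : CuspForm (Gamma0 N) 2},
        C' • W.quadraticTwist 5 = V' → V'.HasGoodReductionAtPrime 5 → V'.frobeniusTrace 5 = 0 → IsNewformOf V' f →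
        ∀ (ϖ : ℚ), (if Even (5 / 2) then (ϖ : ℝ) * V'.realPeriodRat = plusPeriod f
            else (ϖ : ℝ) * V'.imaginaryPeriodRat = minusPeriod f) →
        ϖ * (quadraticBranchMazurTateElement 5 f 1).coeff 1 ≠ 0 ∧
          padicValRat 5 (ϖ * (quadraticBranchMazurTateElement 5 f 1).coeff 1) = 0)
    (hnd : haveI : W.IsElliptic := hW ▸ isElliptic_19600cb1
      ∀ P : W.toAffine.Point, ¬ IsOfFinAddOrder P →
        (∀ R : W.toAffine.Point, ∃ (k : ℤ) (T : W.toAffine.Point), IsOfFinAddOrder T ∧ R = k • P + T) →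
        ∀ Q : (W.baseChange ℚ_[5]).toAffine.Point, 5 • Q ≠ W.toPadicPoint 5 P)
    (hval : haveI : W.IsElliptic := hW ▸ isElliptic_19600cb1
      haveI : W.IsGloballyMinimal := hW ▸ isGloballyMinimal_19600cb1
      ∀ q : ℚ, shaAn W = (q : ℂ) → padicValRat 5 (q * W.tamagawaProduct / (W.torsionOrder : ℚ) ^ 2) = 0) :
    MissingPPartAt W 5 := by
  rw [← show ((-1 : ℚ) ^ ((5 : ℕ) / 2) * ((5 : ℕ) : ℚ)) = (5 : ℚ) by norm_num] at hθ
  subst hW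
  haveI : (⟨0, 0, 0, (-875), 12250⟩ : WeierstrassCurve ℚ).IsElliptic := isElliptic_19600cb1
  haveI : (⟨0, 0, 0, (-875), 12250⟩ : WeierstrassCurve ℚ).IsGloballyMinimal := isGloballyMinimal_19600cb1
  haveI : NeZero (5 : ℕ) := ⟨by norm_num⟩
  haveI : Finite (⟨0, 0, 0, (-875), 12250⟩ : WeierstrassCurve ℚ).sha := (hGZK _ (by omega)).2
  exact missingPPartAt_of_bsdp _ 5 (EtaConjADoorBSDRankOne.bsdp_of_plusEtaMainConjectureAt_of_analyticRank_eq_one _ 5 hGZK hmod hnf hM h12 hKO hGZ h74 (le_refl 5) V C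
      (by rw [show ((-1 : ℚ) ^ ((5 : ℕ) / 2) * ((5 : ℕ) : ℚ)) = 5 by norm_num]; exact hC) hgood hap
      (EtaConjADoorRecords.etaMC_r1_of_classNumber h22 h41 h6273 hGZK 5 (le_refl 5) _ hr V C
        (by rw [show ((-1 : ℚ) ^ ((5 : ℕ) / 2) * ((5 : ℕ) : ℚ)) = 5 by norm_num]; exact hC) hgood hap hns
          (EtaPlusCoeffCongruence.span_eq_span_X_of_mazurTate_padicValRat 5 hmod hM (le_refl 5) _ hr V C
            (by rw [show ((-1 : ℚ) ^ ((5 : ℕ) / 2) * ((5 : ℕ) : ℚ)) = 5 by norm_num]; exact hC) hgood hap hθ₂) hP) hr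
    (EtaMinusCoeffCongruence.minusLeadingValuationAt_zero_of_mazurTate_padicValRat_of_indivisible_of_mazur _ 5 hM (le_refl 5)
      hθ hnd hval))

end Summit.BirchSwinnertonDyer.BirchSwinnertonDyer.Theorems.EtaConjADoorBSDRecordsR1

namespace Summit.BirchSwinnertonDyer.BirchSwinnertonDyer.Theorems.EtaConjADoorBSDRecordsR1

/-- **[R1NS — BOTH analytic data from symbols, k8eta-c2 g24]** The `λ⁻ = 1` record `missingPPartAt_r1n_216225bu1_5_of_classNumber` of this namespace with (a) its displayed
(N1) «every minus branch function `L_5⁻(V,η,X)` has a UNIT coefficient of `X`» (PARI `λ⁻ = 1, μ⁻ = 0`) REPLACED by the level-1 symbol datum «`ϖ · coeff₁θ₁(η)`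
(`θ₁(η) = quadraticBranchMazurTateElement 5 f 1`, `20` symbols `[a/25]⁺`) is a `5`-adic UNIT» (kit j336534: `Σ_{u<5} u·TH₁[u] = 72` = `2^3·3^2`,
`5 ∤`), read by `EtaMinusCoeffCongruence.minusLeadingValuationAt_zero_of_mazurTate_padicValRat_of_indivisible_of_mazur` (`coeff₁L = −v·ϖ·coeff₁θ₁(η) + 5ϖr`), and
(b) its displayed `hX` «`(Lη) = (X)`» (PARI `λ⁺ = 1, μ⁺ = 0`) REPLACED by the level-2 symbol datum «`v₅(ϖ · coeff₁θ₂(η)) = 1`» (kit j336534: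
`Σ_{u<25} u·TH₂[u] = -360` = `−2^3·3^2·5`; `TH₀ = 0`, `Σ_u TH₁[u] = Σ_u TH₂[u] = 0`), read by
`EtaPlusCoeffCongruence.span_eq_span_X_of_mazurTate_padicValRat` (`L_5⁺(0) = 0` from `r_an = 1`; `coeff₁` unit; `‖ϖ‖₅ ≤ 1` from `hM`). No `p`-adic `L`-function
numerics remain in this record; convention changes move both numbers by `5`-adic units. The rest is VERBATIM the r1n record:** **`MissingPPartAt W 5` — `ord_5 #Ш(W) = ord_5 #Ш_an(W)` (from Miller's `BSDp W 5`) — for the CM CornerF in-table prime-`L` rank-one partner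
216225bu1, granted ONE good `a_5 = 0` globally minimal model `V` of `W^{(5)}` with non-onto `5`-adic tower, modulo named facts and DISPLAYED
NUMERICS ONLY (no conjecture instance: the `λ⁻ = 1` shape)** (`W = [0, 0, 1, 0, 28860031]`, CM, `N_W = 216225`; kit QP5 (k8eta-c2 g20) / j326603
(g21) + j332613 (twin λ±/μ±, etacomp) (GRH): `ε(W) = −1`, PARI plus-`η` `(λ, μ) = (1, 0)`, `r_an(W) = 1` (`Cremona rank 1; k8eta-c2 g19/g20
census`); `h(ℚ(P)) = 12`, `h(ℚ(x(P))) = 6`; eigen dimensions `(d₁,d₂,d₃,d₄) = (0,0,0,0)` — door L6 (`5 ∤ h(ℚ(P))`) passes) from the ROW ALONE —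
named facts `hGZK hmod hnf hM h12 hKO hGZ h74 h22 h41 h6273` (GZK, modularity, newforms, Mazur `p ∤ c₀`, Kobayashi Thm. 1.2 / 2.2 / 4.1 / 6.2–7.4,
Kitajima–Otsuki Thm. 1.3, Gross–Zagier I (7.3); Poitou–Tate and the layer comparison are tree theorems); displayed: `r_an(W) = 1`, the twin `V` with
the tower clause, `(L_5⁺(V,η,X)) = (X)`, and — INSTEAD of the crux C-cc-1 at the row — three NUMERICAL data that make its `δ = 0` law trivially true
here: (N1) the level-1 SYMBOL valuation stated above, (N2) no
generator of `W(ℚ)/tors` is `5`-divisible in `W(ℚ_5)` (kit: `ν = 0`), (N3) `v_5(q·Tam/#tors²) = 0` for `q = #Ш_an(W)` (kit: `#Ш_an = 1`, `Tam = 12`,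
`#tors = 1`), the class-group datum. Instance of `EtaConjADoorBSDRankOne.bsdp_of_plusEtaMainConjectureAt_of_analyticRank_eq_one` ∘ g20's
`EtaConjADoorRecords.etaMC_r1_of_classNumber` with `hcc1 :=` `minusLeadingValuationAt_zero_of_unit_coeff_of_indivisible` (k8eta-c2 g22).
CONDITIONAL; nothing booked. [cite: Kobayashi2003, §4 (p. 8), Thm. 2.2 (p. 5)] [cite: CoatesSujatha2005, §3 (A) and Thm. 3.4] [cite: Cremona1997,
Table 1] -/
theorem missingPPartAt_r1ns_216225bu1_5_of_classNumber
    (hGZK : rank_eq_analyticRank_of_analyticRank_le_one) (hmod : hasEntireLFunction_rat)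
    (hnf : exists_isNewformOf) (hM : mazur_not_dvd_maninConstant_of_odd)
    (h12 : Kobayashi2003.thm12_signedSelmerDual_finite_torsion)
    (hKO : KitajimaOtsuki2018.mainThm13_etaSignedSelmerDual_noFiniteSubmodule)
    (hGZ : GrossZagier1986_thm_I_7_3) (h74 : Kobayashi2003.thm74_etaEvenMC_iff_etaOddMC)
    (h22 : Kobayashi2003.thm22_etaSignedSelmerDual_finite_torsion)
    (h41 : Kobayashi2003.thm41_plusEtaCharIdeal_dvd)
    (h6273 : Kobayashi2003.thm62_63_73_etaColemanPoitouTate) [Fact (5 : ℕ).Prime]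
    (W : WeierstrassCurve ℚ) (hW : W = (⟨0, 0, 1, 0, 28860031⟩ : WeierstrassCurve ℚ)) (hr : W.analyticRank = 1)
    (V : WeierstrassCurve ℚ) [V.IsElliptic] [V.IsGloballyMinimal] (C : VariableChange ℚ)
    (hC : C • W.quadraticTwist 5 = V)
    (hgood : V.HasGoodReductionAtPrime 5) (hap : V.frobeniusTrace 5 = 0)
    (hns : ¬ ∀ m : ℕ, V.HasSurjectiveModNGaloisRep (5 ^ m : ℕ))
    (hθ₂ : ∀ {N : ℕ} [NeZero N] {f : CuspForm (Gamma0 N) 2}, IsNewformOf V f →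
      ∀ (ϖ : ℚ), (if Even (5 / 2) then (ϖ : ℝ) * V.realPeriodRat = plusPeriod f
          else (ϖ : ℝ) * V.imaginaryPeriodRat = minusPeriod f) →
      ϖ * (quadraticBranchMazurTateElement 5 f 2).coeff 1 ≠ 0 ∧
        padicValRat 5 (ϖ * (quadraticBranchMazurTateElement 5 f 2).coeff 1) = 1)
    (hP : haveI : W.IsElliptic := hW ▸ isElliptic_216225bu1
      haveI : NeZero (5 : ℕ) := ⟨by norm_num⟩
      haveI : NumberField (W.divisionField 5) := NumberField.mk
      ∃ P : geomTorsion W ((5 : ℕ) : ℤ), P ≠ 0 ∧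
        ¬ 5 ∣ NumberField.classNumber (IntermediateField.fixedField
          ((MulAction.stabilizer (absoluteGaloisGroup ℚ) P).map (absRestrictNormalHom (W.divisionField 5)))))
    (hθ : haveI : W.IsElliptic := hW ▸ isElliptic_216225bu1
      ∀ (V' : WeierstrassCurve ℚ) [V'.IsElliptic] [V'.IsGloballyMinimal] (C' : VariableChange ℚ)
        {N : ℕ} [NeZero N] {f : CuspForm (Gamma0 N) 2},
        C' • W.quadraticTwist 5 = V' → V'.HasGoodReductionAtPrime 5 → V'.frobeniusTrace 5 = 0 → IsNewformOf V' f →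
        ∀ (ϖ : ℚ), (if Even (5 / 2) then (ϖ : ℝ) * V'.realPeriodRat = plusPeriod f
            else (ϖ : ℝ) * V'.imaginaryPeriodRat = minusPeriod f) →
        ϖ * (quadraticBranchMazurTateElement 5 f 1).coeff 1 ≠ 0 ∧
          padicValRat 5 (ϖ * (quadraticBranchMazurTateElement 5 f 1).coeff 1) = 0)
    (hnd : haveI : W.IsElliptic := hW ▸ isElliptic_216225bu1
      ∀ P : W.toAffine.Point, ¬ IsOfFinAddOrder P →
        (∀ R : W.toAffine.Point, ∃ (k : ℤ) (T : W.toAffine.Point), IsOfFinAddOrder T ∧ R = k • P + T) →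
        ∀ Q : (W.baseChange ℚ_[5]).toAffine.Point, 5 • Q ≠ W.toPadicPoint 5 P)
    (hval : haveI : W.IsElliptic := hW ▸ isElliptic_216225bu1
      haveI : W.IsGloballyMinimal := hW ▸ isGloballyMinimal_216225bu1
      ∀ q : ℚ, shaAn W = (q : ℂ) → padicValRat 5 (q * W.tamagawaProduct / (W.torsionOrder : ℚ) ^ 2) = 0) :
    MissingPPartAt W 5 := by
  rw [← show ((-1 : ℚ) ^ ((5 : ℕ) / 2) * ((5 : ℕ) : ℚ)) = (5 : ℚ) by norm_num] at hθ
  subst hW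
  haveI : (⟨0, 0, 1, 0, 28860031⟩ : WeierstrassCurve ℚ).IsElliptic := isElliptic_216225bu1
  haveI : (⟨0, 0, 1, 0, 28860031⟩ : WeierstrassCurve ℚ).IsGloballyMinimal := isGloballyMinimal_216225bu1
  haveI : NeZero (5 : ℕ) := ⟨by norm_num⟩
  haveI : Finite (⟨0, 0, 1, 0, 28860031⟩ : WeierstrassCurve ℚ).sha := (hGZK _ (by omega)).2
  exact missingPPartAt_of_bsdp _ 5 (EtaConjADoorBSDRankOne.bsdp_of_plusEtaMainConjectureAt_of_analyticRank_eq_one _ 5 hGZK hmod hnf hM h12 hKO hGZ h74 (le_refl 5) V C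
      (by rw [show ((-1 : ℚ) ^ ((5 : ℕ) / 2) * ((5 : ℕ) : ℚ)) = 5 by norm_num]; exact hC) hgood hap
      (EtaConjADoorRecords.etaMC_r1_of_classNumber h22 h41 h6273 hGZK 5 (le_refl 5) _ hr V C
        (by rw [show ((-1 : ℚ) ^ ((5 : ℕ) / 2) * ((5 : ℕ) : ℚ)) = 5 by norm_num]; exact hC) hgood hap hns
          (EtaPlusCoeffCongruence.span_eq_span_X_of_mazurTate_padicValRat 5 hmod hM (le_refl 5) _ hr V C
            (by rw [show ((-1 : ℚ) ^ ((5 : ℕ) / 2) * ((5 : ℕ) : ℚ)) = 5 by norm_num]; exact hC) hgood hap hθ₂) hP) hr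
    (EtaMinusCoeffCongruence.minusLeadingValuationAt_zero_of_mazurTate_padicValRat_of_indivisible_of_mazur _ 5 hM (le_refl 5)
      hθ hnd hval))

end Summit.BirchSwinnertonDyer.BirchSwinnertonDyer.Theorems.EtaConjADoorBSDRecordsR1

end
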